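import Literature.Computability.Complexity.CHPrimeBlocks
import HarnessLib

/-!
# The auxiliary moduli `B_s`, `B_s / q` and `A_i` modulo short primes, as `CH`-graph functions

Tenth toolkit file (theorems only) of the scaled-up `FOM + MAJ` calculus. With block length
`L(u) = 2^{ℓ(|u|)}` (an `FP` numeral, `val_pow2Numeral`) and the primes `q < 2^{t|u|}` indexed by
`#{primes < q}`, the level-`s` auxiliary set is `P(u; 2, 2 + L s)` (indices in `[2, 2 + L s)`, so
all its primes are `≥ 5`) and block `i` is `P(u; 2 + L i, 2 + L (i+1))` (Hesse–Allender–Barrington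
2002, proof of Thm. 4.1: "`Aᵢ = ∏_{j=1}^{k} p_{ik+j}`"). This file shows that

* `bmodGraph_mem_CH`: `⟨⟨⟨u, S⟩, e⟩, m⟩ ↦ (∏_{q ∈ P(u; 2, 2 + L·val S), q ≠ val e} q) mod val m`
  (prime `val m`; else `0`) is a `CH`-graph function — `B_s mod m` (`e = 0`) and `(B_s/q) mod m`
  (`e = q`);
* `amodGraph_mem_CH`: `⟨⟨⟨u, S⟩, m⟩, I⟩ ↦ (∏_{q ∈ P(u; 2 + L(val I - 1), 2 + L·val I)} q) mod val m`
  is a `CH`-graph function — `A_i mod m`;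

both by `FP` re-addressing of `blockProdModGraph_mem_CH` (the bounds `lo`, `hi` are `FP`
numerals of the word) and `prod_blockFactor_eq`.

## References

* W. Hesse, E. Allender, D. A. M. Barrington, JCSS 65 (2002), proof of Thm. 4.1.
* P. Bürgisser, ECCC TR06-113 (2006), Thm. 3.4.
-/

namespace Literature.Computability.Complexity

open _root_.Computability Polynomial PRelSigma TTClosure Brick PPSharpP ThresholdPP Plumb Finset

/-- The `FP` numeral `addFn ⟨1^{ℓ(|u|)}, bin 1⟩` has value `2^{ℓ(|u|)}`. [folklore] -/
theorem val_pow2Numeral (ℓ : Polynomial ℕ) (u : List Bool) :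
    bitsToNat (addFn (boolPair (polyFn ℓ u) (encodeNat 1))) = 2 ^ ℓ.eval u.length := by
  rw [addFn_boolPair, bitsToNat_encodeNat, polyFn_apply, bitsToNat_ones, bitsToNat_encodeNat]
  exact Nat.sub_add_cancel Nat.one_le_two_pow

/-- The same value in `simp`-normal form: `val 1^{ℓ(|u|)} + 1 = 2^{ℓ(|u|)}`. [folklore] -/
theorem val_polyFn_add_one (ℓ : Polynomial ℕ) (u : List Bool) : bitsToNat (polyFn ℓ u) + 1 = 2 ^ ℓ.eval u.length := by
  rw [polyFn_apply, bitsToNat_ones]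
  exact Nat.sub_add_cancel Nat.one_le_two_pow

/-- Block products without the exclusion: primes are nonzero, so excluding `0` is vacuous. [folklore] -/
theorem filter_block_ne_zero (N a b : ℕ) :
    (range N).filter (fun q => q.Prime ∧ a ≤ Nat.count Nat.Prime q ∧ Nat.count Nat.Prime q < b ∧ q ≠ 0) =
      (range N).filter (fun q => q.Prime ∧ a ≤ Nat.count Nat.Prime q ∧ Nat.count Nat.Prime q < b) :=
  Finset.filter_congr fun _ _ => ⟨fun h => ⟨h.1, h.2.1, h.2.2.1⟩, fun h => ⟨h.1, h.2.1, h.2.2, h.1.ne_zero⟩⟩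

/-- Block products with one prime excluded are products over the erased set. [folklore] -/
theorem filter_block_ne_eq_erase (N a b e : ℕ) :
    (range N).filter (fun q => q.Prime ∧ a ≤ Nat.count Nat.Prime q ∧ Nat.count Nat.Prime q < b ∧ q ≠ e) =
      ((range N).filter (fun q => q.Prime ∧ a ≤ Nat.count Nat.Prime q ∧ Nat.count Nat.Prime q < b)).erase e := by
  ext q
  simp only [Finset.mem_filter, Finset.mem_range, Finset.mem_erase]
  tauto

section BlockMod

variable (t ℓ : Polynomial ℕ)

/-- **`B_s mod m` and `(B_s/q) mod m` are `CH`-graph functions**: on words `w = ⟨⟨⟨u, S⟩, e⟩, m⟩`,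
`(∏_{q ∈ P(u; 2, 2 + 2^{ℓ|u|}·val S), q ≠ val e} q) mod val m` for prime `val m` (else `0`). [cite: HesseAllenderBarrington2002, Theorem 4.1] -/
theorem bmodGraph_mem_CH :
    {z | (if (bitsToNat (sndP (fstP z))).Prime then
          (∏ q ∈ (range (2 ^ t.eval (fstP (fstP (fstP (fstP z)))).length)).filter (fun q => q.Prime ∧
              2 ≤ Nat.count Nat.Prime q ∧
              Nat.count Nat.Prime q < 2 + 2 ^ ℓ.eval (fstP (fstP (fstP (fstP z)))).length * bitsToNat (sndP (fstP (fstP (fstP z)))) ∧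
              q ≠ bitsToNat (sndP (fstP (fstP z)))), q) % bitsToNat (sndP (fstP z))
        else 0) = bitsToNat (sndP z)} ∈ CH := by
  -- the block-product function `Φ` of `blockProdModGraph_mem_CH`, abstracted
  obtain ⟨Φ, hΦg, hΦ⟩ : ∃ Φ : List Bool → ℕ, {z | Φ (fstP z) = bitsToNat (sndP z)} ∈ CH ∧ ∀ y, Φ y =
      if (bitsToNat (sndP y)).Prime then
        (∏ q ∈ range (2 ^ t.eval (fstP y).length),
          (if (encodeNat q).length ≤ t.eval (fstP (fstP y)).length ∧ q.Prime ∧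
              bitsToNat (fstP (sndP (fstP y))) ≤ Nat.count Nat.Prime q ∧
              Nat.count Nat.Prime q < bitsToNat (fstP (sndP (sndP (fstP y)))) ∧
              q ≠ bitsToNat (sndP (sndP (sndP (fstP y)))) then q else 1)) % bitsToNat (sndP y)
      else 0 := ⟨_, blockProdModGraph_mem_CH t, fun y => rfl⟩
  -- the re-addressing `E w = ⟨⟨u, ⟨bin 2, ⟨bin (2 + L s), e⟩⟩⟩, m⟩`
  have hHI : addFn ∘ pairFn (fun _ => encodeNat 2) (prodFn ∘ pairFn
      (addFn ∘ pairFn (polyFn ℓ ∘ fstP ∘ fstP ∘ fstP) (fun _ => encodeNat 1)) (sndP ∘ fstP ∘ fstP)) ∈ FP :=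
    comp_mem_FP addFn_mem_FP (pairFn_mem_FP (const_mem_FP _) (comp_mem_FP prodFn_mem_FP (pairFn_mem_FP
      (comp_mem_FP addFn_mem_FP (pairFn_mem_FP (comp_mem_FP (polyFn_mem_FP ℓ) (comp_mem_FP fstP_mem_FP
        (comp_mem_FP fstP_mem_FP fstP_mem_FP))) (const_mem_FP _))) (comp_mem_FP sndP_mem_FP (comp_mem_FP fstP_mem_FP fstP_mem_FP)))))
  have hE : pairFn (pairFn (fstP ∘ fstP ∘ fstP) (pairFn (fun _ => encodeNat 2) (pairFn
      (addFn ∘ pairFn (fun _ => encodeNat 2) (prodFn ∘ pairFn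
        (addFn ∘ pairFn (polyFn ℓ ∘ fstP ∘ fstP ∘ fstP) (fun _ => encodeNat 1)) (sndP ∘ fstP ∘ fstP))) (sndP ∘ fstP)))) sndP ∈ FP :=
    pairFn_mem_FP (pairFn_mem_FP (comp_mem_FP fstP_mem_FP (comp_mem_FP fstP_mem_FP fstP_mem_FP))
      (pairFn_mem_FP (const_mem_FP _) (pairFn_mem_FP hHI (comp_mem_FP sndP_mem_FP fstP_mem_FP)))) sndP_mem_FP
  refine mem_CH_of_iff (graph_comp_FP_mem_CH (f := Φ) hΦg hE) _ fun z => ?_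
  change (if (bitsToNat (sndP (fstP z))).Prime then _ else 0) = bitsToNat (sndP z) ↔
    Φ (pairFn (pairFn (fstP ∘ fstP ∘ fstP) (pairFn (fun _ => encodeNat 2) (pairFn
      (addFn ∘ pairFn (fun _ => encodeNat 2) (prodFn ∘ pairFn
        (addFn ∘ pairFn (polyFn ℓ ∘ fstP ∘ fstP ∘ fstP) (fun _ => encodeNat 1)) (sndP ∘ fstP ∘ fstP))) (sndP ∘ fstP)))) sndP
      (fstP z)) = bitsToNat (sndP z)
  simp only [pairFn_apply, Function.comp_apply, bitsToNat_encodeNat, addFn_boolPair, prodFn_boolPair, val_polyFn_add_one]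
  rw [hΦ]
  simp only [fstP_boolPair, sndP_boolPair, bitsToNat_encodeNat]
  split_ifs with hpr
  · rw [prod_blockFactor_eq t (fstP (fstP (fstP (fstP z)))) 2 _ _ _ (Nat.pow_le_pow_right (by norm_num)
      (TM2Iter.eval_mono t (by rw [length_boolPair]; omega)))]
  · rfl

/-- The `B`-residue function is below `2^{|w|}`. [folklore] -/
theorem bmod_lt_two_pow (w : List Bool) :
    (if (bitsToNat (sndP w)).Prime then
          (∏ q ∈ (range (2 ^ t.eval (fstP (fstP (fstP w))).length)).filter (fun q => q.Prime ∧
              2 ≤ Nat.count Nat.Prime q ∧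
              Nat.count Nat.Prime q < 2 + 2 ^ ℓ.eval (fstP (fstP (fstP w))).length * bitsToNat (sndP (fstP (fstP w))) ∧
              q ≠ bitsToNat (sndP (fstP w))), q) % bitsToNat (sndP w)
        else 0) < 2 ^ (X : Polynomial ℕ).eval w.length := by
  rw [eval_X]
  split_ifs with h
  · have hl := length_fstF_sndF_le w
    change 2 * (fstP w).length + (sndP w).length ≤ _ at hl
    exact (Nat.mod_lt _ h.pos).trans ((bitsToNat_lt _).trans_le (Nat.pow_le_pow_right (by norm_num) (by omega)))
  · exact Nat.two_pow_pos _

/-- **`A_i mod m` is a `CH`-graph function**: on words `x = ⟨⟨⟨u, S⟩, m⟩, I⟩`,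
`(∏_{q ∈ P(u; 2 + L (val I - 1), 2 + L·val I)} q) mod val m` for prime `val m` (else `0`),
`L = 2^{ℓ|u|}`. [cite: HesseAllenderBarrington2002, Theorem 4.1] -/
theorem amodGraph_mem_CH :
    {z | (if (bitsToNat (sndP (fstP (fstP z)))).Prime then
          (∏ q ∈ (range (2 ^ t.eval (fstP (fstP (fstP (fstP z)))).length)).filter (fun q => q.Prime ∧
              2 + 2 ^ ℓ.eval (fstP (fstP (fstP (fstP z)))).length * (bitsToNat (sndP (fstP z)) - 1) ≤ Nat.count Nat.Prime q ∧
              Nat.count Nat.Prime q < 2 + 2 ^ ℓ.eval (fstP (fstP (fstP (fstP z)))).length * bitsToNat (sndP (fstP z))), q) %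
            bitsToNat (sndP (fstP (fstP z)))
        else 0) = bitsToNat (sndP z)} ∈ CH := by
  -- the block-product function `Φ` of `blockProdModGraph_mem_CH`, abstracted
  obtain ⟨Φ, hΦg, hΦ⟩ : ∃ Φ : List Bool → ℕ, {z | Φ (fstP z) = bitsToNat (sndP z)} ∈ CH ∧ ∀ y, Φ y =
      if (bitsToNat (sndP y)).Prime then
        (∏ q ∈ range (2 ^ t.eval (fstP y).length),
          (if (encodeNat q).length ≤ t.eval (fstP (fstP y)).length ∧ q.Prime ∧
              bitsToNat (fstP (sndP (fstP y))) ≤ Nat.count Nat.Prime q ∧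
              Nat.count Nat.Prime q < bitsToNat (fstP (sndP (sndP (fstP y)))) ∧
              q ≠ bitsToNat (sndP (sndP (sndP (fstP y)))) then q else 1)) % bitsToNat (sndP y)
      else 0 := ⟨_, blockProdModGraph_mem_CH t, fun y => rfl⟩
  -- `x = ⟨⟨⟨u, S⟩, m⟩, I⟩`: `u = fstP (fstP (fstP x))`, `m = sndP (fstP x)`, `I = sndP x`
  have hL : addFn ∘ pairFn (polyFn ℓ ∘ fstP ∘ fstP ∘ fstP) (fun _ => encodeNat 1) ∈ FP :=
    comp_mem_FP addFn_mem_FP (pairFn_mem_FP (comp_mem_FP (polyFn_mem_FP ℓ) (comp_mem_FP fstP_mem_FP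
      (comp_mem_FP fstP_mem_FP fstP_mem_FP))) (const_mem_FP _))
  have hLO : addFn ∘ pairFn (fun _ => encodeNat 2) (prodFn ∘ pairFn
      (addFn ∘ pairFn (polyFn ℓ ∘ fstP ∘ fstP ∘ fstP) (fun _ => encodeNat 1)) (subFn ∘ pairFn sndP (fun _ => encodeNat 1))) ∈ FP :=
    comp_mem_FP addFn_mem_FP (pairFn_mem_FP (const_mem_FP _) (comp_mem_FP prodFn_mem_FP (pairFn_mem_FP hL
      (comp_mem_FP subFn_mem_FP (pairFn_mem_FP sndP_mem_FP (const_mem_FP _))))))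
  have hHI : addFn ∘ pairFn (fun _ => encodeNat 2) (prodFn ∘ pairFn
      (addFn ∘ pairFn (polyFn ℓ ∘ fstP ∘ fstP ∘ fstP) (fun _ => encodeNat 1)) sndP) ∈ FP :=
    comp_mem_FP addFn_mem_FP (pairFn_mem_FP (const_mem_FP _) (comp_mem_FP prodFn_mem_FP (pairFn_mem_FP hL sndP_mem_FP)))
  have hE : pairFn (pairFn (fstP ∘ fstP ∘ fstP) (pairFn
      (addFn ∘ pairFn (fun _ => encodeNat 2) (prodFn ∘ pairFn
        (addFn ∘ pairFn (polyFn ℓ ∘ fstP ∘ fstP ∘ fstP) (fun _ => encodeNat 1)) (subFn ∘ pairFn sndP (fun _ => encodeNat 1))))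
      (pairFn (addFn ∘ pairFn (fun _ => encodeNat 2) (prodFn ∘ pairFn
        (addFn ∘ pairFn (polyFn ℓ ∘ fstP ∘ fstP ∘ fstP) (fun _ => encodeNat 1)) sndP)) (fun _ => encodeNat 0))))
      (sndP ∘ fstP) ∈ FP :=
    pairFn_mem_FP (pairFn_mem_FP (comp_mem_FP fstP_mem_FP (comp_mem_FP fstP_mem_FP fstP_mem_FP))
      (pairFn_mem_FP hLO (pairFn_mem_FP hHI (const_mem_FP _)))) (comp_mem_FP sndP_mem_FP fstP_mem_FP)
  refine mem_CH_of_iff (graph_comp_FP_mem_CH (f := Φ) hΦg hE) _ fun z => ?_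
  change (if (bitsToNat (sndP (fstP (fstP z)))).Prime then _ else 0) = bitsToNat (sndP z) ↔
    Φ (pairFn (pairFn (fstP ∘ fstP ∘ fstP) (pairFn
      (addFn ∘ pairFn (fun _ => encodeNat 2) (prodFn ∘ pairFn
        (addFn ∘ pairFn (polyFn ℓ ∘ fstP ∘ fstP ∘ fstP) (fun _ => encodeNat 1)) (subFn ∘ pairFn sndP (fun _ => encodeNat 1))))
      (pairFn (addFn ∘ pairFn (fun _ => encodeNat 2) (prodFn ∘ pairFn
        (addFn ∘ pairFn (polyFn ℓ ∘ fstP ∘ fstP ∘ fstP) (fun _ => encodeNat 1)) sndP)) (fun _ => encodeNat 0))))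
      (sndP ∘ fstP) (fstP z)) = bitsToNat (sndP z)
  simp only [pairFn_apply, Function.comp_apply, bitsToNat_encodeNat, addFn_boolPair, prodFn_boolPair, subFn_boolPair, val_polyFn_add_one]
  rw [hΦ]
  simp only [fstP_boolPair, sndP_boolPair, bitsToNat_encodeNat]
  split_ifs with hpr
  · rw [prod_blockFactor_eq t (fstP (fstP (fstP (fstP z)))) _ _ _ _ (Nat.pow_le_pow_right (by norm_num)
      (TM2Iter.eval_mono t (by rw [length_boolPair]; omega))), filter_block_ne_zero]
  · rfl

/-- The `A`-residue function is below `2^{|x|}`. [folklore] -/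
theorem amod_lt_two_pow (x : List Bool) :
    (if (bitsToNat (sndP (fstP x))).Prime then
          (∏ q ∈ (range (2 ^ t.eval (fstP (fstP (fstP x))).length)).filter (fun q => q.Prime ∧
              2 + 2 ^ ℓ.eval (fstP (fstP (fstP x))).length * (bitsToNat (sndP x) - 1) ≤ Nat.count Nat.Prime q ∧
              Nat.count Nat.Prime q < 2 + 2 ^ ℓ.eval (fstP (fstP (fstP x))).length * bitsToNat (sndP x)), q) %
            bitsToNat (sndP (fstP x))
        else 0) < 2 ^ (X : Polynomial ℕ).eval x.length := by
  rw [eval_X]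
  split_ifs with h
  · have hl := length_fstF_sndF_le x
    have hl' := length_fstF_sndF_le (fstP x)
    change 2 * (fstP x).length + (sndP x).length ≤ _ at hl
    change 2 * (fstP (fstP x)).length + (sndP (fstP x)).length ≤ _ at hl'
    exact (Nat.mod_lt _ h.pos).trans ((bitsToNat_lt _).trans_le (Nat.pow_le_pow_right (by norm_num) (by omega)))
  · exact Nat.two_pow_pos _

end BlockMod

end Literature.Computability.Complexity
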